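import Mathlib.Analysis.SpecialFunctions.Sqrt
import Literature.MathematicalPhysics.QuantumLattice.OnsagerLuttingerCount
import HarnessLib

/-!
# The Hall number `n_H = V/(e R_H)` as an exact unit dictionary, the YBCO chain correction, and the
# certified arithmetic behind REFVALS-2 §130 (cell hubbard-downfold): Badoux 2016, Collignon 2017,
# Putzke 2021, Ando 2004

High-field Hall studies of the cuprates report the «Hall number» `n_H = V/(e R_H)` — `V` a volume per
copper (or per formula unit, as each paper states), `e` the elementary charge, `R_H` the Hall coefficient
— and compare it with the nominal hole count `p` or the Luttinger count `1 + p`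
[BadouxEtAl2016YBCOCarrierDensityPseudogap, Methods] [CollignonEtAl2017NdLSCOHallPseudogap, §III C]
[PutzkeEtAl2021, SI Methods] [AndoEtAl2004HallCoefficientEvolution, p. 3].  This file fixes the units
once: with `V` in Å³ and `R_H` in mm³ C⁻¹ (the units every source prints),
`n_H = V·10⁻³⁰ m³ / (e · R_H·10⁻⁹ m³ C⁻¹)`, and REUSES the tree's exact SI charge
`elementaryChargeSI = 1.602176634 × 10⁻¹⁹` of `OnsagerLuttingerCount.lean`, so that

* §1 `hallNumber V R = V/(hallConst · R)` with `hallConst = e·10²¹ = 160.2176634` exactly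
  (`hallConst_eq`, `hallNumber_eq`); the inverse `hallCoefficient V n = V/(hallConst · n)` and the two
  round trips; Ando et al.'s reading «eR_H x/V should be 1 if R_H simply signifies the nominal hole
  density x/V» is `hallNumber V R = x ↔ V = hallConst · R · x` (`ando_identity`);
* §2 the YBCO chain correction of [BadouxEtAl2016YBCOCarrierDensityPseudogap, Methods]: chains conduct in
  parallel with the planes along `b`, `1/ρ_b = 1/ρ_a + 1/ρ_chain` (their
  `ρ_chain = 1/(1/ρ_b − 1/ρ_a)`), hence `ρ_a/ρ_b = 1 + ρ_a/ρ_chain` (`chainRatio`, `anisotropy_of_parallel`)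
  and the planar count `n = n_H/(ρ_a/ρ_b)` (`planarCount`); their numbers `ρ_chain = 50`, `ρ_a = 25 μΩ cm`
  ⇒ `ρ_a/ρ_b = 3/2`, `n_H ≈ 0.24 ⇒ n = 0.16 = p` at `p = 0.16`, `n ≈ 0.9 × 1.3 = 1.17` at `p = 0.205`
  vs `1 + p = 1.205`, and the «sixfold» ratio `(1 + p*)/p*` for `p* = 0.19 ± 0.01`:
  `∈ (6.0, 6.556)`, `6.263…` at `0.19` (printed «6.3») (`badoux_rows`);
* §3 [CollignonEtAl2017NdLSCOHallPseudogap]: `n_H(0) = 1.3 ± 0.1` at `p = 0.24` contains the Luttinger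
  value `1.24`; `ρ(0)/ρ₀ = 5.8` vs `(1 + p)/p = 6` at `p = 0.20` (`collignon_rows`);
* §4 [PutzkeEtAl2021, SI]: the Tl2201 conversion cell `a = 3.87`, `c = 11.6` Å per formula unit gives
  `V = 173.73204` Å³, hence `R_H(n_H = 1) ∈ (1.0843, 1.0844)`, `R_H(n_H = 1.27) ∈ (0.8538, 0.8539)`,
  `R_H(n_H = 0.19) ∈ (5.7071, 5.7072)` mm³ C⁻¹ (`tl2201_rows`); their two-branch doping scale
  `1 − T_c/T_c,max = 82.6 (p − 0.16)²` (`T_c,max = 94` K, `0.16 < p < 0.21`) and `T_c = 231.7 − 748 p`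
  (above): parabola root `0.16 + 1/√82.6 ∈ (0.2700, 0.2701)` (printed 0.27), linear root
  `231.7/748 ∈ (0.30975, 0.30977)` (printed «≃ 0.31»), the seam at `p = 0.21`:
  `|74.589 − 74.62| < 0.05` K («merging smoothly»), and `p(T_c = 40 K) ∈ (0.2562, 0.2563)` on the linear
  branch (printed «approximately at p = 0.25») (`putzke_scale_rows`);
* §5 the La₂₋ₓSrₓCuO₄ per-copper volume from the 300 K cell `a_T = 3.7793`, `c = 13.2260` Å, two coppers
  per body-centred cell [NISTWebHTS2015SRD62, record A00298 (Cava et al. 1987)]: `V/Cu ∈ (94.454, 94.455)`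
  Å³, so Ando et al.'s identity `n_H = x` reads `R_H ∈ (3.930, 3.931)` mm³ C⁻¹ at `x = 0.15` and
  `∈ (8.421, 8.423)` at `x = 0.07` (`lsco_rows`).

Nothing here asserts that `n_H` IS a carrier density — REFVALS-2 §130 records the sources' own caveats
(curvature, anisotropic scattering, chain conduction, Lifshitz transition); the file introduces no named
fact (`def … : Prop`).
-/

noncomputable section

namespace Literature.MathematicalPhysics.QuantumLattice.HallNumber

open Literature.MathematicalPhysics.QuantumLattice

/-! ## §1 The unit dictionary -/

/-- The Hall number `n_H = V/(e R_H)` for `V` in Å³ and `R_H` in mm³ C⁻¹, with the exact SI elementary charge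
of `OnsagerLuttingerCount.lean` [cite: BadouxEtAl2016YBCOCarrierDensityPseudogap, Methods («n_H = V/(eR_H)»)]
[cite: PutzkeEtAl2021, SI Methods]. -/
def hallNumber (V R : ℝ) : ℝ := V / 10 ^ 30 / (elementaryChargeSI * (R / 10 ^ 9))

/-- `e × 10²¹` — the number such that `n_H = V[Å³]/(hallConst · R_H[mm³/C])`
[cite: BadouxEtAl2016YBCOCarrierDensityPseudogap, Methods]. -/
def hallConst : ℝ := elementaryChargeSI * 10 ^ 21

/-- Unfolding lemma for `hallNumber` [cite: BadouxEtAl2016YBCOCarrierDensityPseudogap, Methods]. -/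
theorem hallNumber_def (V R : ℝ) :
    hallNumber V R = V / 10 ^ 30 / (elementaryChargeSI * (R / 10 ^ 9)) := rfl

/-- `hallConst = 160.2176634` exactly [cite: BadouxEtAl2016YBCOCarrierDensityPseudogap, Methods] (2019 SI `e`). -/
theorem hallConst_eq : hallConst = 160.2176634 := by
  unfold hallConst; rw [elementaryChargeSI_def]; norm_num

/-- `hallConst > 0` [cite: BadouxEtAl2016YBCOCarrierDensityPseudogap, Methods]. -/
theorem hallConst_pos : 0 < hallConst := by rw [hallConst_eq]; norm_num

/-- The dictionary in printed units: `n_H = V[Å³]/(160.2176634 · R_H[mm³ C⁻¹])`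
[cite: BadouxEtAl2016YBCOCarrierDensityPseudogap, Methods] [cite: AndoEtAl2004HallCoefficientEvolution, p. 3]. -/
theorem hallNumber_eq (V R : ℝ) : hallNumber V R = V / (hallConst * R) := by
  unfold hallNumber hallConst
  rw [elementaryChargeSI_def]
  by_cases hR : R = 0
  · subst hR; simp
  · field_simp

/-- The inverse map: the Hall coefficient (mm³ C⁻¹) of a count `n` per volume `V` (Å³), `R_H = V/(e n)`
[cite: CollignonEtAl2017NdLSCOHallPseudogap, §III B («R_H(0) ≃ V/e(1 + p)»)]. -/
def hallCoefficient (V n : ℝ) : ℝ := V / (hallConst * n)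

/-- Unfolding lemma for `hallCoefficient` [cite: CollignonEtAl2017NdLSCOHallPseudogap, §III B]. -/
theorem hallCoefficient_def (V n : ℝ) : hallCoefficient V n = V / (hallConst * n) := rfl

/-- Round trip `n_H(R_H(n)) = n` [cite: CollignonEtAl2017NdLSCOHallPseudogap, §III B–C]. -/
theorem hallNumber_hallCoefficient {V n : ℝ} (hV : V ≠ 0) (hn : n ≠ 0) :
    hallNumber V (hallCoefficient V n) = n := by
  rw [hallNumber_eq, hallCoefficient_def]
  have hc : hallConst ≠ 0 := hallConst_pos.ne'
  field_simp

/-- Round trip `R_H(n_H(R)) = R` [cite: CollignonEtAl2017NdLSCOHallPseudogap, §III B–C]. -/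
theorem hallCoefficient_hallNumber {V R : ℝ} (hV : V ≠ 0) (hR : R ≠ 0) :
    hallCoefficient V (hallNumber V R) = R := by
  rw [hallNumber_eq, hallCoefficient_def]
  have hc : hallConst ≠ 0 := hallConst_pos.ne'
  field_simp

/-- `n_H` scales inversely with `R_H`: a factor-`k` larger Hall coefficient is a factor-`k` smaller count
(the «sixfold increase in R_H ⇔ n from 1 + p to p» reading)
[cite: BadouxEtAl2016YBCOCarrierDensityPseudogap, p. 3]. -/
theorem hallNumber_div (V R k : ℝ) (hk : k ≠ 0) : hallNumber V (k * R) = hallNumber V R / k := by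
  rw [hallNumber_eq, hallNumber_eq]
  by_cases hR : R = 0
  · subst hR; simp
  · have hc : hallConst ≠ 0 := hallConst_pos.ne'
    field_simp

/-- Ando et al.'s reading: «eR_H x/V should be 1 if R_H simply signifies the nominal hole density x/V» —
in the dictionary, `n_H = x` iff `V = hallConst · R · x` [cite: AndoEtAl2004HallCoefficientEvolution, p. 3]. -/
theorem ando_identity {V R x : ℝ} (hR : R ≠ 0) : hallNumber V R = x ↔ V = hallConst * R * x := by
  rw [hallNumber_eq]
  have hc : hallConst ≠ 0 := hallConst_pos.ne'
  have h : hallConst * R ≠ 0 := mul_ne_zero hc hR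
  rw [div_eq_iff h]
  constructor <;> intro e <;> linarith [e]

/-! ## §2 The YBCO chain correction of Badoux et al. -/

/-- `ρ_a/ρ_b` when chains (resistivity `ρ_chain`) conduct in parallel with the planes (`ρ_a`) along `b`:
`1 + ρ_a/ρ_chain` [cite: BadouxEtAl2016YBCOCarrierDensityPseudogap, Methods («ρ_chain = 1/(1/ρ_b − 1/ρ_a)»)]. -/
def chainRatio (ρa ρchain : ℝ) : ℝ := 1 + ρa / ρchain

/-- Unfolding lemma for `chainRatio` [cite: BadouxEtAl2016YBCOCarrierDensityPseudogap, Methods]. -/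
theorem chainRatio_def (ρa ρchain : ℝ) : chainRatio ρa ρchain = 1 + ρa / ρchain := rfl

/-- Parallel conduction `ρ_b = 1/(1/ρ_a + 1/ρ_chain)` gives `ρ_a/ρ_b = 1 + ρ_a/ρ_chain`
[cite: BadouxEtAl2016YBCOCarrierDensityPseudogap, Methods]. -/
theorem anisotropy_of_parallel {ρa ρchain : ℝ} (ha : ρa ≠ 0) (hc : ρchain ≠ 0) :
    ρa / (1 / (1 / ρa + 1 / ρchain)) = chainRatio ρa ρchain := by
  unfold chainRatio
  field_simp

/-- Badoux et al.'s own form: `ρ_chain = 1/(1/ρ_b − 1/ρ_a)` with `ρ_b = ρ_a/r`, `r = ρ_a/ρ_b`, returns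
`r = 1 + ρ_a/ρ_chain` [cite: BadouxEtAl2016YBCOCarrierDensityPseudogap, Methods]. -/
theorem chainRatio_of_rho_b {ρa r : ℝ} (ha : ρa ≠ 0) (hr : r ≠ 1) :
    chainRatio ρa (1 / (1 / (ρa / r) - 1 / ρa)) = r := by
  unfold chainRatio
  have h1 : r - 1 ≠ 0 := sub_ne_zero.mpr hr
  have e1 : 1 / (ρa / r) - 1 / ρa = (r - 1) / ρa := by
    field_simp
  rw [e1, one_div_div]
  field_simp
  ring

/-- The planar count `n = n_H/(ρ_a/ρ_b)` [cite: BadouxEtAl2016YBCOCarrierDensityPseudogap, Methods]. -/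
def planarCount (nH r : ℝ) : ℝ := nH / r

/-- Unfolding lemma for `planarCount` [cite: BadouxEtAl2016YBCOCarrierDensityPseudogap, Methods]. -/
theorem planarCount_def (nH r : ℝ) : planarCount nH r = nH / r := rfl

/-- [cite: BadouxEtAl2016YBCOCarrierDensityPseudogap, Methods and p. 3]: `ρ_chain = 50`, `ρ_a = 25 μΩ cm`
⇒ `ρ_a/ρ_b = 1.5`; `n_H ≈ 0.24 ⇒ n = 0.16 (= p)` at `p = 0.16`; at `p = 0.205`, `n ≈ 0.9` at 50 K times the
printed factor `1.3` is `1.17` («≈ 1.2») against `1 + p = 1.205`; the ratio `(1 + p*)/p*` is `6.263…` at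
`p* = 0.19` (printed 6.3) and spans `(6.0, 6.556)` over the printed `p* = 0.19 ± 0.01`. -/
theorem badoux_rows :
    chainRatio 25 50 = 1.5 ∧ planarCount 0.24 1.5 = 0.16 ∧ (0.9 : ℝ) * 1.3 = 1.17 ∧
    (1 : ℝ) + 0.205 = 1.205 ∧ ((1.17 : ℝ) < 1.205) ∧
    ((6.263 : ℝ) < (1 + 0.19) / 0.19 ∧ (1 + 0.19) / (0.19 : ℝ) < 6.264) ∧
    (1 + 0.20) / (0.20 : ℝ) = 6 ∧ ((6.555 : ℝ) < (1 + 0.18) / 0.18 ∧ (1 + 0.18) / (0.18 : ℝ) < 6.556) := by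
  refine ⟨by norm_num [chainRatio], by norm_num [planarCount], by norm_num, by norm_num, by norm_num,
    ⟨by norm_num, by norm_num⟩, by norm_num, ⟨by norm_num, by norm_num⟩⟩

/-- In the dictionary the chain correction is a rescaling of `R_H`: `n = n_H/r = hallNumber V (r R)`
[cite: BadouxEtAl2016YBCOCarrierDensityPseudogap, Methods]. -/
theorem planarCount_eq_hallNumber (V R r : ℝ) (hr : r ≠ 0) :
    planarCount (hallNumber V R) r = hallNumber V (r * R) := by
  rw [planarCount_def, hallNumber_div V R r hr]

/-! ## §3 Collignon et al. (Nd-LSCO) -/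

/-- [cite: CollignonEtAl2017NdLSCOHallPseudogap, §III C]: `n_H(0) = 1.3 ± 0.1` at `p = 0.24` and the
Luttinger count `1 + p = 1.24` lies inside `[1.2, 1.4]`; at `p = 0.20`, `(1 + p)/p = 6` beside the
printed `ρ(0)/ρ₀ = 5.8` (their `n_ρ ≡ (1 + p)ρ₀/ρ(0)` then equals `1.2/5.8·… `: `(1 + 0.2) · (1/5.8)
∈ (0.2068, 0.2069)`, i.e. `n_ρ ≈ p`). -/
theorem collignon_rows :
    (1 : ℝ) + 0.24 = 1.24 ∧ (1.24 : ℝ) ∈ Set.Icc (1.3 - 0.1 : ℝ) (1.3 + 0.1) ∧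
    (1 + 0.20) / (0.20 : ℝ) = 6 ∧ ((5.8 : ℝ) < 6) ∧
    ((0.2068 : ℝ) < (1 + 0.2) / 5.8 ∧ (1 + 0.2) / (5.8 : ℝ) < 0.2069) := by
  refine ⟨by norm_num, ?_, by norm_num, by norm_num, ⟨by norm_num, by norm_num⟩⟩
  constructor <;> norm_num

/-! ## §4 Putzke et al. (Tl2201): conversion cell and doping scale -/

/-- The Tl2201 conversion volume of [cite: PutzkeEtAl2021, SI Methods]: `a = 3.87`, `c = 11.6` Å per
formula unit, `V = a²c`. -/
def tl2201Vol : ℝ := 3.87 ^ 2 * 11.6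

/-- Unfolding lemma for `tl2201Vol` [cite: PutzkeEtAl2021, SI Methods]. -/
theorem tl2201Vol_def : tl2201Vol = 3.87 ^ 2 * 11.6 := rfl

/-- `V = 173.73204` Å³ exactly; the Hall coefficients of the counts `1`, `1 + p = 1.27` (their most overdoped
crystal) and `p = 0.19` on this cell [cite: PutzkeEtAl2021, SI Methods and p. 4–5]. -/
theorem tl2201_rows :
    tl2201Vol = 173.73204 ∧
    ((1.0843 : ℝ) < hallCoefficient tl2201Vol 1 ∧ hallCoefficient tl2201Vol 1 < 1.0844) ∧
    ((0.8538 : ℝ) < hallCoefficient tl2201Vol 1.27 ∧ hallCoefficient tl2201Vol 1.27 < 0.8539) ∧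
    ((5.7071 : ℝ) < hallCoefficient tl2201Vol 0.19 ∧ hallCoefficient tl2201Vol 0.19 < 5.7072) ∧
    ((6.263 : ℝ) < hallCoefficient tl2201Vol 0.19 / hallCoefficient tl2201Vol 1.19 ∧
      hallCoefficient tl2201Vol 0.19 / hallCoefficient tl2201Vol 1.19 < 6.264) := by
  have hV : tl2201Vol = 173.73204 := by norm_num [tl2201Vol]
  refine ⟨hV, ?_, ?_, ?_, ?_⟩ <;> simp only [hallCoefficient_def, hallConst_eq, hV] <;>
    constructor <;> norm_num

/-- The parabolic `T_c(p)` used below `p = 0.21`: `T_c = T_c,max (1 − 82.6 (p − 0.16)²)`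
[cite: PutzkeEtAl2021, SI Eq. (1)]. -/
def parabolicTc (Tmax p : ℝ) : ℝ := Tmax * (1 - 82.6 * (p - 0.16) ^ 2)

/-- The linear high-doping branch `T_c = 231.7 − 748 p` matched to the quantum-oscillation Fermi-surface
volumes [cite: PutzkeEtAl2021, SI p. 15]. -/
def linearTc (p : ℝ) : ℝ := 231.7 - 748 * p

/-- Unfolding lemma for `parabolicTc` [cite: PutzkeEtAl2021, SI Eq. (1)]. -/
theorem parabolicTc_def (Tmax p : ℝ) : parabolicTc Tmax p = Tmax * (1 - 82.6 * (p - 0.16) ^ 2) := rfl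

/-- Unfolding lemma for `linearTc` [cite: PutzkeEtAl2021, SI p. 15]. -/
theorem linearTc_def (p : ℝ) : linearTc p = 231.7 - 748 * p := rfl

/-- The overdoped root of the parabola is `p = 0.16 + 1/√82.6` [cite: PutzkeEtAl2021, SI p. 15 («T_c = 0 at
p = 0.27»)]. -/
theorem parabolicTc_root (Tmax : ℝ) : parabolicTc Tmax (0.16 + 1 / Real.sqrt 82.6) = 0 := by
  unfold parabolicTc
  have hs : Real.sqrt 82.6 ^ 2 = 82.6 := Real.sq_sqrt (by norm_num)
  have h1 : (0.16 + 1 / Real.sqrt 82.6 - 0.16) = 1 / Real.sqrt 82.6 := by ring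
  rw [h1, div_pow, one_pow, hs]
  norm_num

/-- [cite: PutzkeEtAl2021, SI p. 15]: `√82.6 ∈ (9.08845, 9.08846)`, so the parabola's root
`0.16 + 1/√82.6 ∈ (0.2700, 0.2701)` (printed «p = 0.27»); the linear branch vanishes at
`231.7/748 ∈ (0.30975, 0.30977)` (printed «p ≃ 0.31»); at the junction `p = 0.21` the two branches give
`74.589` and `74.62` K — a seam below `0.05` K («merging smoothly»); `T_c = 40` K on the linear branch sits
at `p ∈ (0.2562, 0.2563)` (printed «approximately at p = 0.25»); and `T_c,max = 94` K is recovered at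
`p = 0.16`. -/
theorem putzke_scale_rows :
    ((9.08845 : ℝ) < Real.sqrt 82.6 ∧ Real.sqrt 82.6 < 9.08846) ∧
    ((0.2700 : ℝ) < 0.16 + 1 / Real.sqrt 82.6 ∧ 0.16 + 1 / Real.sqrt 82.6 < 0.2701) ∧
    linearTc (231.7 / 748) = 0 ∧ ((0.30975 : ℝ) < 231.7 / 748 ∧ (231.7 : ℝ) / 748 < 0.30977) ∧
    parabolicTc 94 0.21 = 74.589 ∧ linearTc 0.21 = 74.62 ∧ |parabolicTc 94 0.21 - linearTc 0.21| < 0.05 ∧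
    linearTc ((231.7 - 40) / 748) = 40 ∧ ((0.2562 : ℝ) < (231.7 - 40) / 748 ∧ (231.7 - 40) / (748 : ℝ) < 0.2563) ∧
    parabolicTc 94 0.16 = 94 := by
  have hs : (9.08845 : ℝ) < Real.sqrt 82.6 ∧ Real.sqrt 82.6 < 9.08846 := by
    constructor
    · rw [Real.lt_sqrt (by norm_num)]; norm_num
    · rw [Real.sqrt_lt' (by norm_num)]; norm_num
  have hpos : 0 < Real.sqrt 82.6 := by linarith [hs.1]
  have hinv : 1 / (9.08846 : ℝ) < 1 / Real.sqrt 82.6 ∧ 1 / Real.sqrt 82.6 < 1 / 9.08845 :=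
    ⟨one_div_lt_one_div_of_lt hpos hs.2, one_div_lt_one_div_of_lt (by norm_num) hs.1⟩
  have hp1 : parabolicTc 94 0.21 = 74.589 := by norm_num [parabolicTc]
  have hl1 : linearTc 0.21 = 74.62 := by norm_num [linearTc]
  refine ⟨hs, ⟨?_, ?_⟩, by norm_num [linearTc], ⟨by norm_num, by norm_num⟩, hp1, hl1, ?_,
    by norm_num [linearTc], ⟨by norm_num, by norm_num⟩, by norm_num [parabolicTc]⟩
  · have : (0.11 : ℝ) < 1 / 9.08846 := by norm_num
    linarith [hinv.1]
  · have : 1 / (9.08845 : ℝ) < 0.1101 := by norm_num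
    linarith [hinv.2]
  · rw [hp1, hl1]; norm_num

/-! ## §5 La₂₋ₓSrₓCuO₄: the per-copper volume behind Ando et al.'s `eR_H x/V = 1` -/

/-- Volume per copper of the body-centred La₂₋ₓSrₓCuO₄ cell (two formula units): `a²c/2` with the 300 K
cell `a_T = 3.7793`, `c = 13.2260` Å [cite: NISTWebHTS2015SRD62, record A00298 (Cava et al. 1987,
La1.85Sr0.15CuO4 cell parameters)]. -/
def lscoVolPerCu : ℝ := 3.7793 ^ 2 * 13.2260 / 2

/-- Unfolding lemma for `lscoVolPerCu` [cite: NISTWebHTS2015SRD62, record A00298]. -/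
theorem lscoVolPerCu_def : lscoVolPerCu = 3.7793 ^ 2 * 13.2260 / 2 := rfl

/-- `V/Cu ∈ (94.454, 94.455)` Å³; Ando et al.'s low-doping identity `n_H = x`
[cite: AndoEtAl2004HallCoefficientEvolution, p. 3 («eR_Hx/V is actually 1 at around 100 K for x = 0.02 –
0.07»)] then corresponds to `R_H = V/(hallConst·x) ∈ (8.421, 8.423)` mm³ C⁻¹ at `x = 0.07` and — where it no
longer holds as a density — `(3.930, 3.931)` at `x = 0.15`; the count `1 + x = 1.15` would read
`(0.5126, 0.5127)` mm³ C⁻¹. -/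
theorem lsco_rows :
    ((94.454 : ℝ) < lscoVolPerCu ∧ lscoVolPerCu < 94.455) ∧
    ((8.421 : ℝ) < hallCoefficient lscoVolPerCu 0.07 ∧ hallCoefficient lscoVolPerCu 0.07 < 8.423) ∧
    ((3.930 : ℝ) < hallCoefficient lscoVolPerCu 0.15 ∧ hallCoefficient lscoVolPerCu 0.15 < 3.931) ∧
    ((0.5126 : ℝ) < hallCoefficient lscoVolPerCu 1.15 ∧ hallCoefficient lscoVolPerCu 1.15 < 0.5127) := by
  simp only [hallCoefficient_def, hallConst_eq, lscoVolPerCu]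
  refine ⟨⟨by norm_num, by norm_num⟩, ⟨by norm_num, by norm_num⟩, ⟨by norm_num, by norm_num⟩,
    ⟨by norm_num, by norm_num⟩⟩

/-- Ando et al.'s identity instantiated on this cell: with `R_H = V/(hallConst · x)` the Hall number IS `x`
(any `x ≠ 0`) [cite: AndoEtAl2004HallCoefficientEvolution, p. 3]. -/
theorem lsco_ando_roundtrip {x : ℝ} (hx : x ≠ 0) :
    hallNumber lscoVolPerCu (hallCoefficient lscoVolPerCu x) = x :=
  hallNumber_hallCoefficient (by norm_num [lscoVolPerCu]) hx

end Literature.MathematicalPhysics.QuantumLattice.HallNumber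

end
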